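import Mathlib
import Literature.Probability.RandomPlanarGeometry.HexSAW
import Summits.CriticalPhenomena.SAWScalingLimit.Theorems.SAWDefectDecoherenceObservableToSLERGateDefs

/-!
# Objects of the line `bridge-gate-renewal`, reshape r3 (NESTED TAME GATE FAMILIES), for the crux
# `ObservableToSLER` (stmt-CriticalPhenomena-14005)

Lead prover `prover-line-stmt-CriticalPhenomena-14005-c1-0` (crux protocol; reshaped skeleton
`Summits/CriticalPhenomena/SAWScalingLimit/Cruxes/ObservableToSLER/Lines/bridge_gate_renewal.lean`,
reshape r3 of 2026-08-16).  This file only DEFINES the objects the reshaped stubs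
`stub_nestedRenewal`, `stub_carvedToSLEN`, `stub_nestedTransfer` speak about, so that the stub files
under `Theorems/` and the skeleton share ONE copy of them (precedent and companion:
`Theorems/SAWDefectDecoherenceObservableToSLERGateDefs.lean`, whose `hexBall`, `HasCleanWindow`,
`carvedWeight`, `carvedLaw` are reused verbatim).  No statement of the line is asserted or even
named here.

Why the reshape (one paragraph; details in the skeleton header): the r1/r2 abundance input over
lattice-HEXAGON levels around the root is false as typed (fat lattice-hexagonal spiral,
`Cruxes/ObservableToSLER/NegativeNote-RenewalAccumulation-g2.md`: fixed-foliation obstruction), so the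
gate geometry is made domain-adapted and chosen after the mesh: a gate family is a NESTED sequence of
vertex sets, and nestedness alone (no crosscut topology) makes the first good gate prefix-determined.

* `TameNestedFamily δ R N c S` — a nested sequence `S 0 ⊆ S 1 ⊆ ⋯` of vertex sets containing the
  root `c`, inside the closed `R`-ball about the rescaled root, each connected in the honeycomb
  lattice and each a union of at most `N` lattice hexagons `hexBall t k` (tameness: the carved
  domains form a compact finite-dimensional class; connectivity: no holes; locality: short prefixes,
  separated ends);
* `IsFirstExitFrom S l m p q` — the list `l` first leaves the vertex set `S` at index `m` through the
  edge `{p, q}`;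
* `WideEscape Ω δ ρ R S c q` — a continuous path from within `ρ` of the rescaled gate vertex `q` to
  distance `≥ 2R` from the rescaled root whose closed `ρ/4`-balls stay inside `Ω` and `ρ/4`-away from
  the rescaled vertices of `S` (no neck on the exit route of the carved domain);
* `IsGoodGateN`, `IsFirstGoodGateN`, `GoodRenewalAtN` — good gate of a list at level `n` of a family
  (first exit from `S n`, no return to `S n`, clean flat `ρ`-window w.r.t. `S n`, wide escape),
  minimal good level, existence of a good level.

Sources: H. Kesten, J. Math. Phys. 4 (1963) §4 (bridges, renewal); T. Alberts, H. Duminil-Copin,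
arXiv:0909.0203 (bridge points / lines of the restriction measure); B. Dyhr, M. Gilbert, T. Kennedy,
G. Lawler, S. Passon, arXiv:1008.4321 §2 (strip SAW, renewal sections); H. Duminil-Copin, S. Smirnov,
Ann. of Math. 175 (2012) (arXiv:1007.0575) §4 (the critical hexagonal SAW `hexSAWLaw`).
Deliberately NOT here: any statement or theorem of the line (only the bookkeeping lemma
`stub_firstGoodGateN`: a list with a good level has a minimal good level).
-/

noncomputable section

open scoped BigOperators Topology NNReal ENNReal Classical
open Filter Set MeasureTheory Metric
open Literature.Probability.LatticeModels (HexVertex hexGraph hexCenter triZeta Site)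
open Literature.Probability.RandomPlanarGeometry
open Literature.Probability.RandomPlanarGeometry.SAW

namespace Summit.CriticalPhenomena.SAWScalingLimit.Theorems.ObservableToSLER.NestedGate

open Summit.CriticalPhenomena.SAWScalingLimit.Theorems.ObservableToSLER.BridgeGate
  (hexBall HasCleanWindow carvedWeight carvedLaw)

/-- A **TAME NESTED GATE FAMILY** at the root `c`, locality scale `R`, complexity `N`, mesh `δ`:
a nested sequence of vertex sets `S 0 ⊆ S 1 ⊆ ⋯`, each containing `c`, each inside the closed
`R`-ball about the rescaled root, each CONNECTED in the honeycomb lattice and each a union of at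
most `N` lattice hexagons `hexBall t k`.  (Tameness keeps the carved domains in a compact
finite-dimensional class; connectivity excludes holes; locality bounds prefixes and separates the
two ends; nestedness gives product cells.) -/
def TameNestedFamily (δ R : ℝ) (N : ℕ) (c : HexVertex) (S : ℕ → Set HexVertex) : Prop :=
  (∀ n, S n ⊆ S (n + 1)) ∧ (∀ n, c ∈ S n) ∧
    (∀ n, ∀ v ∈ S n, dist ((δ : ℂ) * hexCenter v) ((δ : ℂ) * hexCenter c) ≤ R) ∧
    (∀ n, (hexGraph.induce (S n)).Preconnected) ∧
    (∀ n, ∃ L : List (HexVertex × ℕ), L.length ≤ N ∧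
      ∀ v : HexVertex, v ∈ S n ↔ ∃ tk ∈ L, v ∈ hexBall tk.1 tk.2)

/-- `l` makes its FIRST EXIT from the vertex set `S` at index `m` through the edge `{p, q}`: the
first `m` entries lie in `S`, the last of them is `p`, the next entry `q` lies outside `S`. -/
def IsFirstExitFrom (S : Set HexVertex) (l : List HexVertex) (m : ℕ) (p q : HexVertex) : Prop :=
  (l.take m).getLast? = some p ∧ (l.drop m).head? = some q ∧ (∀ v ∈ l.take m, v ∈ S) ∧ q ∉ S

/-- A **`ρ/4`-WIDE ESCAPE** from the gate vertex `q` to distance `2R` from the root `c`, avoiding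
the removed set `S` and `∂Ω` with margin `ρ/4`: a continuous path starting within `ρ` of the
rescaled `q` and ending at distance `≥ 2R` from the rescaled root, every point of which has its
closed `ρ/4`-ball inside `Ω` and at distance `≥ ρ/4` from every rescaled vertex of `S` (no neck on
the exit route of the carved domain). -/
def WideEscape (Ω : Set ℂ) (δ ρ R : ℝ) (S : Set HexVertex) (c q : HexVertex) : Prop :=
  ∃ (x y : ℂ) (γ : Path x y), dist x ((δ : ℂ) * hexCenter q) ≤ ρ ∧
    2 * R ≤ dist y ((δ : ℂ) * hexCenter c) ∧
    ∀ t, closedBall (γ t) (ρ / 4) ⊆ Ω ∧ ∀ v ∈ S, ρ / 4 ≤ dist (γ t) ((δ : ℂ) * hexCenter v)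

/-- A **GOOD GATE of `l` at level `n` of the family `S`** (root `c`): `l` first leaves `S n`
through `{p, q}` at index `m`, NEVER RETURNS to `S n`, the gate carries a clean flat `ρ`-window
with respect to `S n`, and a `ρ/4`-wide escape. -/
def IsGoodGateN (Ω : Set ℂ) (δ ρ R : ℝ) (S : ℕ → Set HexVertex) (c : HexVertex) (l : List HexVertex)
    (n m : ℕ) (p q : HexVertex) : Prop :=
  IsFirstExitFrom (S n) l m p q ∧ (∀ v ∈ l.drop m, v ∉ S n) ∧
    HasCleanWindow Ω δ ρ (S n) p q ∧ WideEscape Ω δ ρ R (S n) c q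

/-- The FIRST good gate: a good gate at the minimal good level. -/
def IsFirstGoodGateN (Ω : Set ℂ) (δ ρ R : ℝ) (S : ℕ → Set HexVertex) (c : HexVertex)
    (l : List HexVertex) (n m : ℕ) (p q : HexVertex) : Prop :=
  IsGoodGateN Ω δ ρ R S c l n m p q ∧
    ∀ (n' m' : ℕ) (p' q' : HexVertex), IsGoodGateN Ω δ ρ R S c l n' m' p' q' → n ≤ n'

/-- `l` has a good gate at some level of the family. -/
def GoodRenewalAtN (Ω : Set ℂ) (δ ρ R : ℝ) (S : ℕ → Set HexVertex) (c : HexVertex)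
    (l : List HexVertex) : Prop :=
  ∃ (n m : ℕ) (p q : HexVertex), IsGoodGateN Ω δ ρ R S c l n m p q

/-- Bookkeeping (registered helper `stub_firstGoodGateN`): a list with a good gate at some level
has a FIRST good gate (minimal good level; `Nat.find`). Used by the assembly to label cells. -/
theorem stub_firstGoodGateN :
    ∀ (Ω : Set ℂ) (δ ρ R : ℝ) (S : ℕ → Set HexVertex) (c : HexVertex) (l : List HexVertex),
      GoodRenewalAtN Ω δ ρ R S c l →
        ∃ (n m : ℕ) (p q : HexVertex), IsFirstGoodGateN Ω δ ρ R S c l n m p q := by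
  intro Ω δ ρ R S c l h
  classical
  have hex : ∃ n, ∃ (m : ℕ) (p q : HexVertex), IsGoodGateN Ω δ ρ R S c l n m p q := by
    obtain ⟨n, m, p, q, h⟩ := h
    exact ⟨n, m, p, q, h⟩
  obtain ⟨m, p, q, hgood⟩ := Nat.find_spec hex
  refine ⟨Nat.find hex, m, p, q, hgood, ?_⟩
  intro n' m' p' q' h'
  exact Nat.find_min' hex ⟨m', p', q', h'⟩

end Summit.CriticalPhenomena.SAWScalingLimit.Theorems.ObservableToSLER.NestedGate

end
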